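import Mathlib
import Summits.CriticalPhenomena.Ising3DConformalLimit.Theses.GaussianScaleMixture
import Summits.CriticalPhenomena.Ising3DConformalLimit.Theorems.GSMRigidity.Negative.ThreeAtomKernel
import Summits.CriticalPhenomena.Ising3DConformalLimit.Theorems.GSMRigidity.Negative.SwapPencilJump
import Summits.CriticalPhenomena.Ising3DConformalLimit.Theorems.GSMRigidity.Negative.PlannerFamily
import Literature.MathematicalPhysics.QuantumFieldTheory.LatticeMirrorNormals
import Literature.MathematicalPhysics.QuantumFieldTheory.MirrorRPKernel
import Literature.Analysis.SpecialFunctions.IsStieltjesFunction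

/-!
# Line `swap-pencil-branch-arc` — skeleton for the crux `GaussianScaleMixture.GSMRigidity`
(crux item stmt-CriticalPhenomena-8366, rank 3, route `route-CriticalPhenomena-GaussianScaleMixture`;
crux-plan round 1, 2026-08-16; idea `Ideas/swap-pencil-branch-arc.md` ≈ `Ideas/pinched-pencil-edge.md`
(triage r1-1/2/3: pass ×3, merged), = the standing disprover's paper proof F3 (audited F8) of
`Cruxes/GSMRigidity/Disproof.lean`, cut into SIX registered stubs + a kernel-checked composition.)

Crux (FIXED, by name): `GSMRigidity` — a continuous positive kernel `K` on `ℝ³∖{0}`, homogeneous of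
degree `-2Δ`, `1/2 ≤ Δ ≤ 1`, invariant AND reflection positive w.r.t. the nine `B₃` lattice mirror
normals `eᵢ, eᵢ ± eⱼ`, which is moreover a Gaussian scale mixture off the origin
(`K x = ∫ exp(-Σ sᵢxᵢ²) dν(s)`, `ν` on the closed octant), is invariant under every linear isometry.

THE LINE (one complex variable `t` = swap-mirror momentum, transverse momentum along `eᵢ+eⱼ`, `k₃ = 0`).
Write `p := 3/2 - Δ ∈ [1/2, 1]`.
* S1 `stub_polarForm` (Disproof F1/F8(o); M–L) — GSM + homogeneity of degree `-2Δ < 0` ⇒ SIMPLEX FORM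
  `K x = ∫ (ω·x²)^{-Δ} dΦ(ω)` (`x ≠ 0`), `Φ` a FINITE measure carried by the open 2-simplex
  (Laplace uniqueness on the open octant ⇒ `ν` is `Δ`-homogeneous ⇒ `ν = r^{Δ-1}dr ⊗ Φ₀`, faces null,
  `Γ(Δ)` absorbed into `Φ`).
* S2a `stub_bernsteinWidder` (Widder 1941 Thm VI.21 in the continuous form of Boas–Widder 1940 /
  BergChristensenRessel1984 §4.6; L) — a continuous function on `(0,∞)`, positive definite on the
  semigroup `((0,∞),+)` and bounded on `[1,∞)`, is the Laplace transform of a positive measure on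
  `[0,∞)`. The one external theorem of the dictionary, isolated as a named one-variable stub (shared
  debt with every k-side line of this crux and of `HRP2Rigidity`; announced "NOT here" in
  `MirrorRPKernel.lean`).
* S2b `stub_swapPencilStieltjes` (THE DICTIONARY, Disproof F2/F8(i)(ii)/F9(i); HARDEST, L–XL given S2a) —
  for the simplex-form kernel, reflection positivity in ONE swap mirror `xᵢ = xⱼ` makes the special
  swap pencil (transverse momentum `(eᵢ+eⱼ)/√2`, third momentum `0`), written as the Gegenbauer-type
  transform `t ↦ ∫_{(0,π)} (t² - 2t cos θ + 1)^{-p} dG(θ)` of a FINITE angle measure `G` (push-forward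
  of `c_ω a_ω^{-p} Φ_sym` by `θ_ω = arccos ρ_ω`, `ρ_ω = (ωᵢ-ωⱼ)/(ωᵢ+ωⱼ)` — the CIRCLE LEMMA
  `Negative.swapSlice_factor`: all singularities on `|t| = 1`), equal on `(0,1) ∪ (1,∞)` to `g(t²)`
  with `g` a Stieltjes function; `G` is symmetric about `π/2` (the RP form only sees the
  swap-symmetrised kernel) and faithful: `G(0,π/2) = 0 ⇒ Φ{ωᵢ ≠ ωⱼ} = 0`. RP IS CONSUMED HERE
  (`Negative.not_gsmRigidity_without_RP`: it must be somewhere). Proof route: finite-point RP ⇒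
  Schwartz-smeared RP at positive mirror times ⇒ Plancherel on the Gaussian representation ⇒ the
  swap-time function `u ↦ 𝒦_Φ(u;q)` is positive definite on `((0,∞),+)`, continuous, bounded ⇒ S2a ⇒
  Laplace transform ⇒ its `u`-Fourier transform `∫ 2E/(E²+t²) dμ_q(E)` is Stieltjes in `s = t²` and
  equals the explicit 3-D Gaussian/Γ-integral formula `c ∫ c_ω (a_ω t² + 2b_ω t + a_ω + q_w²/ω_k)^{-p} dΦ`
  for `q_w ≠ 0`; monotone limit `q_w ↓ 0` of Stieltjes functions, finite on `(0,1)∪(1,∞)` by the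
  `W`-majorant `∫ 2^p(ωᵢωⱼ)^{p-1/2}ω_k^{-1/2}(ωᵢ+ωⱼ)^{-p} dΦ ≤ 2√3·2^p Σ∫ω_l^{-Δ}dΦ < ∞` (uses
  `1/2 ≤ Δ ≤ 1` and `Σω = 1`), is Stieltjes.
* S3 `stub_pencilContinuation` (Disproof F3 Step 1 / F8(iii), "Taylor radius"; M–L) — a SYMMETRIC finite
  `G` on `(0,π)` whose transform is `g(t²)` on `(0,1)∪(1,∞)` with `g` Stieltjes: the transform is even
  and analytic on the unit `t`-disc (majorant `(1-|t|)^{-2p}`), so `g` continues across `(-1,0)` with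
  real boundary values ⇒ (Stieltjes–Perron inversion + boundedness at `0`) the representing measure of
  `g` has no mass in `[0,1)` ⇒ `F z := g(z²)` is analytic on `U = ℂ ∖ {iy : |y| ≥ 1}` and equals the
  transform on `(0,1)∪(1,∞)` — i.e. the disprover's `SwapPencilAnalytic G p`, inlined. (Symmetry of `G`
  is NECESSARY here: for `G = δ_{θ₀}`, `θ₀ ∈ (π/2,π)`, `g(s) = (s + 2|cos θ₀|√s + 1)^{-p}` IS Stieltjes
  but the transform has branch points `e^{±iθ₀} ∈ U`.)
* S4 `stub_sliceRigidity` (= Disproof `SliceRigidity p`, `0 < p < 1`, F3 Steps 3–4 / F8(iv)–(vi); L) —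
  monodromy jump across the arc `{e^{iφ} : 0 < φ < π/2}` with ONE phase (`Negative.arcBase_eq`),
  dominated radial limits for a.e. `φ`, continuity of `F` across the arc ⇒ jumps vanish ⇒
  `Negative.jump_positivity_ae` ⇒ `G(0,π/2) = 0`.
* S5 `stub_sliceRigidityOne` (the endpoint `p = 1` ⇔ `Δ = 1/2`, Disproof F8(vii); M–L) — where
  `e^{2πip} = 1`: the atoms are pole pairs (`Negative.atom_pOne_partialFraction`), the transform is a
  Cauchy-type transform along the arc, and analyticity across the open arc kills `G` there by the weak
  Plemelj jump (test against `χ ∈ C_c^∞(arc)`; localise: the density `1/(2 sin θ)` is only locally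
  finite, keep far-away atoms in the combined bounded form `1/((t-e^{iθ})(t-e^{-iθ}))`).
* `GSMRigidity_of : GSMRigidity` — kernel-checked composition: S1; for the swaps `(0,1)` and `(1,2)`
  (both among the nine normals, `n = eᵢ - eⱼ`): S2b(S2a) → S3 → S4 (`1/2 < Δ`) or S5 (`Δ = 1/2`) →
  bridge ⇒ `Φ{ω₀ ≠ ω₁} = Φ{ω₁ ≠ ω₂} = 0`; ENDGAME PROVED HERE (no stub): `Φ`-a.e. `ω = (1/3,1/3,1/3)`,
  so `K x = ∫ (‖x‖²/3)^{-Δ} dΦ` is a function of `‖x‖` and `K (R x) = K x` (`x = 0` trivially).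

Hypotheses of the crux used: GSM + homogeneity (S1), `1/2 ≤ Δ ≤ 1` (S2b finiteness of `G`; the split
S4/S5), continuity off `0` (S2b, convenience), RP for TWO swap normals `e₀-e₁`, `e₁-e₂` (S2b). NOT used:
positivity, the nine invariances, the three coordinate and the four remaining diagonal RPs — consistent
with Disproof F4/F9(iii) (with the invariances ONE swap would do via `S₃`-averaging; two swaps avoid
the Laplace-uniqueness bookkeeping that exchangeability of `Φ` would cost).

Disproof.lean (cycles 1–2, NO KILL, F3 audited TRUE) and the LANDED Negative lemmas honoured (imported
above so that this file is elaborated next to them): `Negative.not_gsmRigidity_without_RP` /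
`gsmRigidity_of_withoutRP` (LOAD-BEARING: RP must be used) — RP is the `IsMirrorRPKernel` hypothesis of
S2b, invoked twice in `GSMRigidity_of`; the witnesses `threeAtomKernel` (`threeAtomKernel_not_swapRP`)
and `plannerKernel ε` (`plannerKernel_half_not_swapRP`, `plannerKernel_fifth_not_swapRP`) are simplex-form
kernels whose angle measures `G` charge `(0,π/2)`, so by S3–S5 read contrapositively their swap pencils
are not Stieltjes — they meet no stub's hypotheses and contradict no stub's conclusion.
`Negative.swapSlice_factor` / `swapSlice_rho_abs_lt_one` / `swapSlice_rho_eq_zero_iff` are S2b's change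
of variables; `Negative.arcBase_eq(')`, `jumpIntegrand_pos`, `measure_Ioo_eq_zero_of_jump_eq_zero`,
`jump_positivity(_ae|_of_frequently)` are S4's closing; `Negative.atom_pOne_partialFraction` is S5's
first line; `swapSlice_factor_offplane` is WHY S2b must reach `q_w = 0` (no circle lemma off the plane).
F8(ii)'s sentence "K̂ finite on the axes" (false for `Δ < 1` in general, cards 5/6) is used NOWHERE: every
stub sees the pencil on `(0,1) ∪ (1,∞)` only, and `g(1) < ∞` comes out of S2b for free. No stub is an
instance of a refuted statement (`ledger negatives --problem CriticalPhenomena`: 8 items, all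
SAW/Cardy/percolation); Disproof.lean has no `-- Targets` entry against this line.
-/

noncomputable section

namespace Summit.CriticalPhenomena.Ising3DConformalLimit.Cruxes.GSMRigidity.SwapPencilBranchArc

open scoped BigOperators InnerProductSpace
open MeasureTheory Filter Set
open Literature.MathematicalPhysics.QuantumFieldTheory
open Summit.CriticalPhenomena.Ising3DConformalLimit.Theses.GaussianScaleMixture

set_option linter.unusedVariables false

/-! ## S1 — polar / simplex form of a homogeneous Gaussian scale mixture -/

/-- **S1 `stub_polarForm`** (Disproof F1 / F8(o); Laplace uniqueness on the open octant +
homogeneous measures are products in polar coordinates). If `K` is homogeneous of degree `-2Δ`,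
`Δ > 0`, and a Gaussian scale mixture off the origin in the sense of the crux (`ν` on the closed
octant, integrand integrable and `K x = ∫ e^{-Σ sᵢxᵢ²} dν` at every `x ≠ 0`), then there is a FINITE
measure `Φ` carried by the open simplex `{ω : ωᵢ > 0, Σωᵢ = 1}` with
`K x = ∫ (Σ ωᵢxᵢ²)^{-Δ} dΦ(ω)` (integrable) for every `x ≠ 0`.
Why true: `K(cx) = c^{-2Δ}K(x)` says `(c² ·)_*ν` and `c^{-2Δ}ν` have the same Laplace transform on
the open octant; both become finite with equal mgf near `0` after the density `e^{-s·u₀}`, so they are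
equal (1-D mgf uniqueness on every marginal + `Measure.ext_of_charFun`); hence `ν(λA) = λ^Δ ν(A)`,
`ν{0} = 0`, every face `{sᵢ = 0}` is dilation invariant of finite mass (`≤ ∫e^{-sᵢ}dν = K(eᵢ)`-type
bound) hence null; on `(0,∞) × simplex`, `m_B(t) := ν((1,t]·B)` solves `m_B(ts) = m_B(t) + t^Δ m_B(s)`,
so `ν = r^{Δ-1}dr ⊗ Φ₀` (π-system uniqueness, `ν` finite on `{|s|₁ ≤ R}` by integrability at
`x = (1,1,1)`), and `∫₀^∞ r^{Δ-1}e^{-rL}dr = Γ(Δ)L^{-Δ}`; put `Φ := Γ(Δ)Φ₀`. Size M–L. -/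
theorem stub_polarForm :
    ∀ (Δ : ℝ) (K : EuclideanSpace ℝ (Fin 3) → ℝ), 0 < Δ →
      (∀ c : ℝ, 0 < c → ∀ x, K (c • x) = c ^ (-(2 * Δ)) * K x) →
      (∃ ν : Measure (Fin 3 → ℝ), ν {s | ∃ i, s i < 0} = 0 ∧ ∀ x, x ≠ 0 →
          Integrable (fun s => Real.exp (-∑ i, s i * (x i) ^ 2)) ν ∧
          K x = ∫ s, Real.exp (-∑ i, s i * (x i) ^ 2) ∂ν) →
      ∃ Φ : Measure (Fin 3 → ℝ), IsFiniteMeasure Φ ∧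
        Φ {ω | (∀ i, 0 < ω i) ∧ ∑ i, ω i = 1}ᶜ = 0 ∧
        ∀ x, x ≠ 0 →
          Integrable (fun ω => (∑ i, ω i * (x i) ^ 2) ^ (-Δ)) Φ ∧
          K x = ∫ ω, (∑ i, ω i * (x i) ^ 2) ^ (-Δ) ∂Φ := by
  sorry

/-! ## S2a — Bernstein–Widder on the half-line semigroup -/

/-- **S2a `stub_bernsteinWidder`** (Widder 1941, *The Laplace Transform*, Thm VI.21, with "analytic"
weakened to "continuous" as Widder remarks on p. 171 (Boas–Widder 1940); BergChristensenRessel1984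
Ch. 4 §6). A function `f`, continuous on `(0,∞)`, of positive type on the semigroup `((0,∞),+)`
(`Σ_{a,b} c_a c_b f(u_a+u_b) ≥ 0` for all finite families of `u_a > 0` and real `c_a`) and bounded on
`[1,∞)`, is the Laplace transform of a positive measure carried by `[0,∞)`:
`f u = ∫ e^{-uE} dμ(E)` (integrable) for every `u > 0`. Why true: Widder VI.21 gives a TWO-sided
Laplace–Stieltjes representation `∫_ℝ e^{-ut}dα(t)` converging on `(0,∞)`; mass on `t < -δ` would force
`f(u) ≥ e^{δu}α((-∞,-δ)) → ∞`, contradicting boundedness, so `α` lives on `[0,∞)`. Not in Mathlib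
(no positive-definite functions on semigroups; `MirrorRPKernel.lean` lists it under "NOT here"). Size L;
pure one-variable analysis, independent of everything else in this file. -/
theorem stub_bernsteinWidder :
    ∀ f : ℝ → ℝ, ContinuousOn f (Set.Ioi 0) →
      (∃ C : ℝ, ∀ u : ℝ, 1 ≤ u → |f u| ≤ C) →
      (∀ (m : ℕ) (u : Fin m → ℝ) (c : Fin m → ℝ), (∀ a, 0 < u a) →
          0 ≤ ∑ a, ∑ b, c a * c b * f (u a + u b)) →
      ∃ μ : Measure ℝ, μ (Set.Iio 0) = 0 ∧
        ∀ u : ℝ, 0 < u → Integrable (fun E => Real.exp (-(u * E))) μ ∧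
          f u = ∫ E, Real.exp (-(u * E)) ∂μ := by
  sorry

/-! ## S2b — the dictionary: one swap RP ⇒ the special swap pencil is a Stieltjes function of `t²` -/

/-- **S2b `stub_swapPencilStieltjes`** (THE DICTIONARY — Disproof F2, F8(i)–(ii), F9(i); the
HARDEST stub; RP is consumed here). Hypotheses: the Bernstein–Widder statement S2a (fed in by the
composition, so this stub is provable before S2a lands); `1/2 ≤ Δ ≤ 1`; `K` continuous off `0` and in
simplex form `K x = ∫(ω·x²)^{-Δ}dΦ` (`Φ` finite, carried by the open simplex); `K` reflection positive
for the swap mirror `xᵢ = xⱼ` (normal `eᵢ - eⱼ`, one of the nine). Conclusion: there are a finite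
measure `G` on `(0,π)`, symmetric under `θ ↦ π - θ`, with
`G(0,π/2) = 0 ⇒ Φ{ωᵢ ≠ ωⱼ} = 0`, and a Stieltjes function `g` (tree predicate
`Literature.Analysis.SpecialFunctions.IsStieltjesFunction`) such that for `t > 0`, `t ≠ 1`,
`∫_{(0,π)} (t² - 2t cos θ + 1)^{-(3/2-Δ)} dG(θ) = g(t²)`.
Intended `G`: with `Φ_sym := (Φ + (swap ij)_*Φ)/2`, `p := 3/2-Δ`, `a_ω = (1/ωᵢ+1/ωⱼ)/2`,
`ρ_ω = (ωᵢ-ωⱼ)/(ωᵢ+ωⱼ)`, `c_ω = (ω₀ω₁ω₂)^{-1/2}`: `G := c·(arccos ∘ ρ)_*(c_ω a_ω^{-p} Φ_sym)` — then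
the left side is `c ∫ c_ω (a_ω t² + 2b_ω t + a_ω)^{-p} dΦ_sym`, the explicit Fourier transform of the
degree-`-2Δ` mixture on the pencil `k = t(eᵢ-eⱼ)/√2 + (eᵢ+eⱼ)/√2` (`Negative.swapSlice_factor`:
`a t² + 2b t + a = a(t² - 2ρt + 1)`; `|ρ| < 1`, `Negative.swapSlice_rho_abs_lt_one`, so `G` lives on
`(0,π)`; `G` finite by the `W`-majorant of F8(ii), which is where `1/2 ≤ Δ ≤ 1` and `Σω = 1` enter;
symmetric because `Φ_sym` is; faithful because the density is `> 0` and `arccos ρ < π/2 ⇔ ωᵢ > ωⱼ`,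
applied to `Φ` and to `(swap)_*Φ`). Why Stieltjes (F8(i)): finite-point RP (real coefficients ⇒ only
`K_sym = ∫(ω·x²)^{-Δ}dΦ_sym` is seen) ⇒ RP smeared with Schwartz transverse test functions at mirror
times `u_a > 0` (Riemann sums; `K` bounded continuous on `{mirror time ≥ δ}`) ⇒ Plancherel/Fubini on
the Gaussian representation (`(ω·x²)^{-Δ} = Γ(Δ)^{-1}∫₀^∞ r^{Δ-1}e^{-rω·x²}dr`) ⇒ for every transverse
momentum `q = (q_v,q_w)`, `q_v q_w ≠ 0`, the swap-time function `u ↦ 𝒦(u;q)` (explicit: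
`∫dΦ_sym (π/√(σω_k)) cos(ρ q_v u) ∫₀^∞ r^{Δ-2} e^{-η u² r - C_q/r} dr/Γ(Δ)`, `σ=(ωᵢ+ωⱼ)/2`,
`η = 2ωᵢωⱼ/(ωᵢ+ωⱼ)`, `C_q = q_v²/(4σ)+q_w²/(4ω_k)`, Disproof F10) is continuous, `→ 0`, positive
definite on `((0,∞),+)` (approximate identity `|ψ̂_L|² → δ_q`, continuity of `𝒦(U;·)` at `q ≠ 0`) ⇒ S2a
⇒ `𝒦(u;q) = ∫e^{-Eu}dμ_q(E)` ⇒ (`𝒦(·;q) ∈ L¹(du)` since its integral is `K̂(q) < ∞` off the axes)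
its Fourier transform in `u` is `∫ 2E/(E²+t²)dμ_q(E) = g_q(t²)`, `g_q` Stieltjes, and equals (atomwise
Gaussian transforms + `∫₀^∞ r^{Δ-1}r^{-3/2}e^{-C/r}dr = Γ(p)C^{-p}`) the explicit formula
`c∫c_ω(a_ωt² + 2b_ωt + a_ω + q_w²/ω_k)^{-p}dΦ_sym` at `q_v = 1`; as `q_w ↓ 0` these increase to the left
side above, finite for `t ≠ 1` (`t²-2ρt+1 ≥ (t-1)²`), and a finite pointwise limit of Stieltjes
functions is Stieltjes (`g(1) < ∞` then comes for free: Stieltjes functions are finite on `(0,∞)`).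
Why it might fail: only through a slip in the distributional bookkeeping (the transverse slice
`y ↦ K(u,y)` is NOT `L¹` for `Δ ≤ 1`; Plancherel must be done atomwise on Gaussians with positive
majorants) — audited in F8(i). Size L–XL; the lead may reshape it into (u-side positive definiteness)
+ (t-side evaluation and `q_w ↓ 0`) if a worker needs smaller pieces. -/
theorem stub_swapPencilStieltjes :
    (∀ f : ℝ → ℝ, ContinuousOn f (Set.Ioi 0) →
      (∃ C : ℝ, ∀ u : ℝ, 1 ≤ u → |f u| ≤ C) →
      (∀ (m : ℕ) (u : Fin m → ℝ) (c : Fin m → ℝ), (∀ a, 0 < u a) →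
          0 ≤ ∑ a, ∑ b, c a * c b * f (u a + u b)) →
      ∃ μ : Measure ℝ, μ (Set.Iio 0) = 0 ∧
        ∀ u : ℝ, 0 < u → Integrable (fun E => Real.exp (-(u * E))) μ ∧
          f u = ∫ E, Real.exp (-(u * E)) ∂μ) →
    ∀ (Δ : ℝ) (K : EuclideanSpace ℝ (Fin 3) → ℝ) (Φ : Measure (Fin 3 → ℝ)) (i j : Fin 3),
      i ≠ j → 1 / 2 ≤ Δ → Δ ≤ 1 → ContinuousOn K {0}ᶜ →
      IsFiniteMeasure Φ → Φ {ω | (∀ l, 0 < ω l) ∧ ∑ l, ω l = 1}ᶜ = 0 →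
      (∀ x, x ≠ 0 →
          Integrable (fun ω => (∑ l, ω l * (x l) ^ 2) ^ (-Δ)) Φ ∧
          K x = ∫ ω, (∑ l, ω l * (x l) ^ 2) ^ (-Δ) ∂Φ) →
      Literature.MathematicalPhysics.QuantumFieldTheory.IsMirrorRPKernel
        (EuclideanSpace.single i (1 : ℝ) - EuclideanSpace.single j 1) K →
      ∃ G : Measure ℝ, IsFiniteMeasure G ∧ G (Set.Ioo 0 Real.pi)ᶜ = 0 ∧
        G.map (fun θ : ℝ => Real.pi - θ) = G ∧
        (G (Set.Ioo 0 (Real.pi / 2)) = 0 → Φ {ω | ω i ≠ ω j} = 0) ∧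
        ∃ g : ℝ → ℝ, Literature.Analysis.SpecialFunctions.IsStieltjesFunction g ∧
          ∀ t : ℝ, 0 < t → t ≠ 1 →
            ∫ θ in Set.Ioo 0 Real.pi, (t ^ 2 - 2 * t * Real.cos θ + 1) ^ (-(3 / 2 - Δ)) ∂G =
              g (t ^ 2) := by
  sorry

/-! ## S3 — Taylor radius: the Stieltjes pencil continues to `ℂ ∖ {iy : |y| ≥ 1}` -/

/-- **S3 `stub_pencilContinuation`** (Disproof F3 Step 1 / F8(iii); delivers the disprover's
`SwapPencilAnalytic G p`, inlined). Let `G` be a finite measure on `(0,π)`, SYMMETRIC under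
`θ ↦ π - θ`, whose transform `f(t) = ∫_{(0,π)}(t² - 2t cos θ + 1)^{-p}dG(θ)` (`p > 0`) agrees on
`(0,1) ∪ (1,∞)` with `g(t²)`, `g` a Stieltjes function (`a/s + b + ∫dσ(τ)/(s+τ)`). Then some `F`,
analytic on `U = {z : ¬(Re z = 0 ∧ |Im z| ≥ 1)}`, equals `f` on `(0,1) ∪ (1,∞)`. Why true:
`t² - 2t cos θ + 1 = (1 - te^{iθ})(1 - te^{-iθ})` stays off `(-∞,0]` for `|t| < 1`, so `f` is analytic
on the unit disc with `|integrand| ≤ (1-|t|)^{-2p}`, and EVEN by the symmetry of `G`; hence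
`s ↦ f(√s)` is analytic on the unit `s`-disc, real on `(-1,1)`, and equals `g` on the slit disc; so
`g` is bounded near `s = 0` (`a = 0`) and has real, two-sided-equal boundary values on `(-1,0)`, whence
`σ((0,1)) = 0` by Stieltjes–Perron inversion (Poisson-kernel limit of `Im g(-E+iε)`); then
`F z := b + ∫_{[1,∞)} dσ(τ)/(z² + τ)` is analytic where `z² ∉ (-∞,-1]`, i.e. on `U`, and
`F t = g(t²) = f(t)`. The symmetry hypothesis cannot be dropped (`G = δ_{θ₀}`, `θ₀ > π/2`: `g`
Stieltjes, branch points `e^{±iθ₀}` inside `U`). Size M–L (Stieltjes inversion for the tree's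
`IsStieltjesFunction` is not yet in the tree). -/
theorem stub_pencilContinuation :
    ∀ (p : ℝ) (G : Measure ℝ) (g : ℝ → ℝ), 0 < p → IsFiniteMeasure G →
      G (Set.Ioo 0 Real.pi)ᶜ = 0 → G.map (fun θ : ℝ => Real.pi - θ) = G →
      Literature.Analysis.SpecialFunctions.IsStieltjesFunction g →
      (∀ t : ℝ, 0 < t → t ≠ 1 →
        ∫ θ in Set.Ioo 0 Real.pi, (t ^ 2 - 2 * t * Real.cos θ + 1) ^ (-p) ∂G = g (t ^ 2)) →
      ∃ F : ℂ → ℂ, DifferentiableOn ℂ F {z : ℂ | ¬ (z.re = 0 ∧ 1 ≤ |z.im|)} ∧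
        ∀ t : ℝ, 0 < t → t ≠ 1 →
          F t = ((∫ θ in Set.Ioo 0 Real.pi, (t ^ 2 - 2 * t * Real.cos θ + 1) ^ (-p) ∂G : ℝ) : ℂ) := by
  sorry

/-! ## S4 — slice rigidity for `0 < p < 1` (monodromy jump + jump positivity) -/

/-- **S4 `stub_sliceRigidity`** (= Disproof `SliceRigidity p` for `0 < p < 1`, audited TRUE in F8;
F3 Steps 3–4). A finite measure `G` on `(0,π)` whose transform `∫(t²-2t cos θ+1)^{-p}dG(θ)` is the
restriction to `(0,1) ∪ (1,∞)` of a function analytic on `U = ℂ ∖ {iy : |y| ≥ 1}` charges no angle in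
`(0,π/2)`. Why true: with branches `b_θ` of `((t-e^{iθ})(t-e^{-iθ}))^{-p}` slit along the arcs
`e^{±iθ} → ±i` and the imaginary rays, `Φ̃ := ∫ b_θ dG` is analytic on the unit disc and on
`{|t| > 1} ∖ rays` and equals `F` on both (identity theorem from `(0,1)`, resp. `(1,∞)` — positive reals
only, no symmetry of `G` needed); for a.e. `φ ∈ (0,π/2)` (those with `∫|φ-θ|^{-p}dG < ∞`, dominated
radial limits, F8(vi)) the inside/outside limits at `e^{iφ}` differ by
`(e^{2πipσ}-1)e^{-ipχ(φ)}2^{-p}∫_{(0,φ)}(cos θ - cos φ)^{-p}dG(θ)` — ONE phase for all atoms `θ < φ` by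
`Negative.arcBase_eq` — while continuity of `F` at `e^{iφ} ∈ U` forces the jump to vanish;
`e^{2πip} ≠ 1` for `0 < p < 1`; conclude with `Negative.jump_positivity_ae`. Size L (one complex
variable: `Complex.cpow` branches along arcs, dominated convergence, a.e. Fubini). -/
theorem stub_sliceRigidity :
    ∀ (p : ℝ) (G : Measure ℝ), 0 < p → p < 1 → IsFiniteMeasure G → G (Set.Ioo 0 Real.pi)ᶜ = 0 →
      (∃ F : ℂ → ℂ, DifferentiableOn ℂ F {z : ℂ | ¬ (z.re = 0 ∧ 1 ≤ |z.im|)} ∧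
        ∀ t : ℝ, 0 < t → t ≠ 1 →
          F t = ((∫ θ in Set.Ioo 0 Real.pi, (t ^ 2 - 2 * t * Real.cos θ + 1) ^ (-p) ∂G : ℝ) : ℂ)) →
      G (Set.Ioo 0 (Real.pi / 2)) = 0 := by
  sorry

/-! ## S5 — slice rigidity at the endpoint `p = 1` (`Δ = 1/2`): Cauchy transform on the arc -/

/-- **S5 `stub_sliceRigidityOne`** (Disproof F8(vii): `SliceRigidity 1`). Same statement at `p = 1`,
where the monodromy factor `e^{2πip} - 1` vanishes and S4's mechanism is replaced by the
Plemelj–Sokhotski jump: by `Negative.atom_pOne_partialFraction` the transform is, near any point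
`e^{iφ₀}` of the open arc `A = {e^{iφ} : 0 < φ < π/2}`, a Cauchy transform
`∫ dμ(ζ)/(t-ζ)` of the measure `μ = (e^{iθ})_*(G/(2i sin θ))` restricted to angles near `φ₀` plus a
function analytic near `e^{iφ₀}` (atoms `e^{-iθ}` live in the lower half-plane, atoms `θ` far from `φ₀`
are analytic near `e^{iφ₀}`, kept in the bounded combined form); if `F` continues the transform
analytically across `A`, then for `χ ∈ C_c^∞(A)`:
`∫χ(ζ)[C_μ((1-ε)ζ) - C_μ((1+ε)ζ)]dζ → 2πi∫χ dμ` (approximate identity along the arc) and `→ 0`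
(continuity of `F`), so `μ|_A = 0`, i.e. `G(0,π/2) = 0` (density `1/(2 sin θ) > 0`). Size M–L. -/
theorem stub_sliceRigidityOne :
    ∀ (G : Measure ℝ), IsFiniteMeasure G → G (Set.Ioo 0 Real.pi)ᶜ = 0 →
      (∃ F : ℂ → ℂ, DifferentiableOn ℂ F {z : ℂ | ¬ (z.re = 0 ∧ 1 ≤ |z.im|)} ∧
        ∀ t : ℝ, 0 < t → t ≠ 1 →
          F t = ((∫ θ in Set.Ioo 0 Real.pi,
            (t ^ 2 - 2 * t * Real.cos θ + 1) ^ (-(1 : ℝ)) ∂G : ℝ) : ℂ)) →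
      G (Set.Ioo 0 (Real.pi / 2)) = 0 := by
  sorry

/-! ## Composition — the crux by name, modulo the six stubs; the endgame is proved here -/

/-- **`GSMRigidity_of`**: the line closes the crux. S1 gives the simplex form; for each of the two
swaps `(0,1)`, `(1,2)` the chain S2b(S2a) → S3 → S4/S5 → bridge empties `{ωᵢ ≠ ωⱼ}`; hence `Φ`-a.e.
`ω = (1/3,1/3,1/3)`, `K x = ∫ (‖x‖²/3)^{-Δ} dΦ` depends on `‖x‖` only, and `‖R x‖ = ‖x‖`. -/
theorem GSMRigidity_of : GSMRigidity := by
  intro Δ K hΔ1 hΔ2 hcont hpos hhom hnine hgsm R x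
  -- the origin is fixed by every linear isometry
  by_cases hx : x = 0
  · subst hx; simp
  -- S1: simplex form of the Gaussian scale mixture
  obtain ⟨Φ, hΦfin, hΦsupp, hrep⟩ := stub_polarForm Δ K (by linarith) hhom hgsm
  -- reflection positivity for the swap mirrors `xᵢ = xⱼ` (normal `eᵢ - eⱼ`, among the nine)
  have hRP : ∀ i j : Fin 3, i ≠ j →
      IsMirrorRPKernel (EuclideanSpace.single i (1 : ℝ) - EuclideanSpace.single j 1) K :=
    fun i j hij => (hnine _ ⟨i, j, hij, Or.inr (Or.inr rfl)⟩).2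
  -- one swap empties `{ωᵢ ≠ ωⱼ}`: S2b(S2a) → S3 → S4 / S5 → bridge
  have hpair : ∀ i j : Fin 3, i ≠ j → Φ {ω | ω i ≠ ω j} = 0 := by
    intro i j hij
    obtain ⟨G, hGfin, hGsupp, hGsymm, hbridge, g, hg, hpencil⟩ :=
      stub_swapPencilStieltjes stub_bernsteinWidder Δ K Φ i j hij hΔ1 hΔ2 hcont hΦfin hΦsupp hrep
        (hRP i j hij)
    have hp0 : 0 < 3 / 2 - Δ := by linarith
    have hF := stub_pencilContinuation (3 / 2 - Δ) G g hp0 hGfin hGsupp hGsymm hg hpencil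
    refine hbridge ?_
    rcases eq_or_lt_of_le hΔ1 with hΔeq | hΔlt
    · -- `Δ = 1/2`, `p = 1`: the Cauchy-transform endpoint
      have hp1 : (3 : ℝ) / 2 - Δ = 1 := by linarith
      rw [hp1] at hF
      exact stub_sliceRigidityOne G hGfin hGsupp hF
    · -- `1/2 < Δ ≤ 1`, `0 < p < 1`: monodromy jump
      exact stub_sliceRigidity (3 / 2 - Δ) G hp0 (by linarith) hGfin hGsupp hF
  -- ENDGAME: `Φ` sits at the centre of the simplex
  have hS : ∀ᵐ ω ∂Φ, (∀ l, 0 < ω l) ∧ ∑ l, ω l = 1 := by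
    filter_upwards [measure_eq_zero_iff_ae_notMem.1 hΦsupp] with ω hω
    simpa using hω
  have h01 : ∀ᵐ ω ∂Φ, ω 0 = ω 1 := by
    filter_upwards [measure_eq_zero_iff_ae_notMem.1 (hpair 0 1 (by decide))] with ω hω
    simpa using hω
  have h12 : ∀ᵐ ω ∂Φ, ω 1 = ω 2 := by
    filter_upwards [measure_eq_zero_iff_ae_notMem.1 (hpair 1 2 (by decide))] with ω hω
    simpa using hω
  have hae : ∀ᵐ ω ∂Φ, ∀ l, ω l = 1 / 3 := by
    filter_upwards [hS, h01, h12] with ω hω h₁ h₂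
    have hsum : ω 0 + ω 1 + ω 2 = 1 := by simpa [Fin.sum_univ_three] using hω.2
    intro l
    fin_cases l
    · show ω 0 = 1 / 3
      linarith
    · show ω 1 = 1 / 3
      linarith
    · show ω 2 = 1 / 3
      linarith
  -- so the simplex-form integral is a function of `‖x‖` alone
  have key : ∀ y : EuclideanSpace ℝ (Fin 3),
      ∫ ω, (∑ l, ω l * (y l) ^ 2) ^ (-Δ) ∂Φ = ∫ ω, ((1 / 3 : ℝ) * ‖y‖ ^ 2) ^ (-Δ) ∂Φ := by
    intro y
    refine integral_congr_ae ?_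
    filter_upwards [hae] with ω hω
    simp only [hω, EuclideanSpace.real_norm_sq_eq, Finset.mul_sum]
  have hRx : R x ≠ 0 := fun h => hx (R.injective (by rw [map_zero]; exact h))
  rw [(hrep (R x) hRx).2, (hrep x hx).2, key, key, LinearIsometryEquiv.norm_map]

end Summit.CriticalPhenomena.Ising3DConformalLimit.Cruxes.GSMRigidity.SwapPencilBranchArc
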